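import Summits.QuantumFields.YangMills.Theorems.BalabanUVNodesK0RecordFormatNamesFluctF
import Summits.QuantumFields.YangMills.Theorems.BalabanUVNodesPortS1FlatLQt

/-!
# K0⁷ — THE RECORD-SIDE FORMAT NAMES, EDITION 28 = FLUCTUATION CARRIERS, SOCKET (o4-a): `𝐄_k` READ IN THE CHART — `recordEkChart` ∕ `recordEkBracket`
# (▶ porter PT-A-1 g9's located brick list `EK-CHART-BRICKS-v1.md` b0872ae801a4fced row (o4-a), nodeO STATUS 2026-08-31 l.5704: «DEF `recordEkChart … B x := 𝐄_k(… (pert … (portVkAx … B) x))` — S,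
# DEF-1 names it; type it against `pert`, NOT against `D̃`»; ★★★ №587: the stage-2 sockets left are (o1) `D̃` · (o3) `Tr log` · (o4) `E_k`)

Cell `ym-nodeO-ideate` ∕ `ym-balaban-port`, DEFINER seat `ym-nodeO-def-1` (gen 39); `--kind definition --supports stmt-QuantumFields-20541 --as helper`; count-neutral.
[I] = [Balaban1987RG1].

WHY.  Print's (2.12)∕(2.13) exponent carries the curly bracket «{𝐄_k(U_k(exp i[g_kCB − hD̃(g_kCB)]V^{(k)})) − 𝐄_k(U_k(V^{(k)}))}» with `𝐄_k` of (0.22)∕(0.23)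
(`𝐄_k(V) = Σ_{j<k}[−β_j A^η(U_kV) + 𝓝_{j+1}(Ū^{j+1}(U_kV))]`).  Stage 2's closed `recordFluctInt F Mc a₀ ε₂₉ k v n` needs `𝐄_k` READ AT THE CHART POINT `V′V^{(k)}_{ax}(W_B)` in the
fluctuation coordinates `x` — socket (o4).  ▶ PT-A-1's recommendation (adopted): type it against the chart `pert` (the re-parametrisation `x ↦ Cx − hD̃(Cx)` composes INSIDE the
integral later, so (o4-a) is independent of (o1)).  CURRENCY DECISION (this seat): the HISTORY currency of `phiFE`∕`recordΦfAx` — `𝐄_k` = lit's K-generic ✓`Node00.ZeroInput.EkT`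
over the SAME transport∕cut-off∕background-radius tokens as ✓`recordTermsAx` (`TβOfRecord₁₃ F 2`, `chiβOfRecord₁₃Ax F 2 θfill`, `θfill.εbg`) and the history `extd v` — NOT the
run-parameter twin `EkOfRecordT β p` (PT-A-1's sketch), so that the bracket lives in the currency `PortRecordFEHalfBox`'s `phiFE F Mc a₀ ε₂₉ k v n` already speaks.

WHAT THIS FILE IS (two definitions + `rfl`∕one-line faces; NEW names; nothing earlier touched):
* ★ `recordEkChart F a₀ ε₂₉ k v K B x := ZeroInput.EkT F 2 (TβOfRecord₁₃ F 2) (chiβOfRecord₁₃Ax F 2 θfill) θfill.εbg K (extd v) k (pert F k K (portVkAx F a₀ ε₂₉ k K B) x)` —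
  `𝐄_k` (`A_k + (1∕g_k²)A(U_k ·)`, (0.22)) at the chart point `exp(iB′(x))·V^{(k)}_{ax}(W_B)` ((2.4) `pert`, ed.15), history `v` (`g_j = v j`, `extd`).
* ★ `recordEkBracket F a₀ ε₂₉ k v K B x := recordEkChart … B x − recordEkChart … B 0` — print's curly bracket BEFORE the `D̃` re-parametrisation and before the `g_kC·` scaling
  of the variable (both compose inside the stage-2 integral); faces `recordEkBracket_zero` (`= 0` at `x = 0`), `recordEkChart_zero` (at `x = 0` the chart sits at the background:
  `= EkT … (portVkAx … B)`, by ✓`pert_zero`).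
NOT HERE: (o4-b) the (0.22)∕(0.23) unfoldings (porter, S); (o4-c) the minimiser in the chart `U_k(pert V^{(k)} x) = finePert (U_kV^{(k)}) (recordH1 x + O(x²))` — its linear part is
ed.15c's ✓`recordH1`, the real-analytic germ is P0-ℝ (def-Y ∕ the consumer's `hP9`); (o4-d) continuity∕measurability glue; (o4-e) analyticity + localisation of `x ↦ 𝓝_{j+1}(…)`,
`j < k` = ⟨27930⟩ at lower levels (the induction of [I] §§3–5) — NONE asserted.

HONEST FRAMING.  Definitions only; NOTHING of Bałaban is asserted, ported or discharged; JUNK (said, inherited from ✓`EkT`∕`mainTermT`): at a history with `v (Fin.last k) = 0`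
Mathlib's `1 ∕ 0 = 0` kills the background summand — a junk value off every in-interval run, never read by a face of record; `pert`∕`portVkAx` junk off the small-field regime as
SAID in ed.15 ∕ ✓`…PortS1HalvesDefs`; `recordFluctInt`, (o1), (o3) NOT in the tree; `stub_FE` (XXL) ∕ `stub_P0C` OPEN, ⟨27930⟩ OPEN (1∕3); K0⁷ ∕ K0ᴬ ∕ K1ᴬ ∕ K3ᴬ OPEN; NODE O 0∕1;
COUNT 8∕28 · K 1∕4 UNMOVED; finite `𝕋⁴_{L^K}` at fixed ε — NOT continuum ∕ ℝ⁴ ∕ OS; **the Yang–Mills mass gap (Clay) is NOT proved by any of this.**  No `sorry`, `instance`,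
`notation`; standard axioms.
-/

noncomputable section

namespace Summit.QuantumFields.YangMills.Theorems.K0RecordFormatNames

open Literature.MathematicalPhysics.QuantumFieldTheory.Balaban1983to89
open Literature.MathematicalPhysics.QuantumFieldTheory.Balaban1983to89.Node00
open Literature.MathematicalPhysics.QuantumFieldTheory.Balaban1983to89.T4Continuum (T4Family)
open Literature.MathematicalPhysics.QuantumFieldTheory.Balaban1983to89.T4FlagMemory (extd)
open Summit.QuantumFields.YangMills.Theorems.BalabanUVNodesPortS1 (portVkAx pert_zero)

variable (F : T4Family)

/-! ## §24n  Socket (o4-a): `𝐄_k` in the chart and print's curly bracket -/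

/-- ★ **`𝐄_k` READ IN THE CHART — `recordEkChart F a₀ ε₂₉ k v K B x`** := lit's K-generic `𝐄_k = A_k + (1∕g_k²)A(U_k ·)` (✓`Node00.ZeroInput.EkT`, (0.22)) over the record's
transport∕cut-off∕radius tokens of ✓`recordTermsAx` (`TβOfRecord₁₃ F 2`, `chiβOfRecord₁₃Ax F 2 θfill`, `θfill.εbg`, `θfill := thetaFill F a₀ ε₂₉`) and the history `extd v`,
EVALUATED at the chart point `pert F k K (portVkAx F a₀ ε₂₉ k K B) x = exp(iB′(x))·V^{(k)}_{ax}(W_B)` ((2.4)).  Socket (o4-a) of stage 2; typed against `pert`, not `D̃`.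
[cite: Balaban1987RG1, (0.22) p.256, (2.4) p.266, (2.12)–(2.13) p.268] -/
def recordEkChart (a₀ ε₂₉ : ℝ) (k : ℕ) (v : Fin (k + 1) → ℝ) (K : ℕ) (B : recordW F a₀ ε₂₉ k K) (x : FluctIdx F k K → ℝ) : ℝ :=
  letI θ := thetaFill F a₀ ε₂₉
  ZeroInput.EkT F 2 (TβOfRecord₁₃ F 2) (chiβOfRecord₁₃Ax F 2 θ) θ.εbg K (extd v) k (pert F k K (portVkAx F a₀ ε₂₉ k K B) x)

/-- Unfolding (`rfl`). [cite: Balaban1987RG1, (0.22) p.256 (bookkeeping)] -/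
theorem recordEkChart_eq (a₀ ε₂₉ : ℝ) (k : ℕ) (v : Fin (k + 1) → ℝ) (K : ℕ) (B : recordW F a₀ ε₂₉ k K) (x : FluctIdx F k K → ℝ) :
    recordEkChart F a₀ ε₂₉ k v K B x =
      ZeroInput.EkT F 2 (TβOfRecord₁₃ F 2) (chiβOfRecord₁₃Ax F 2 (thetaFill F a₀ ε₂₉)) (thetaFill F a₀ ε₂₉).εbg K (extd v) k
        (pert F k K (portVkAx F a₀ ε₂₉ k K B) x) := rfl

/-- FACE: at `x = 0` the chart sits at the background, so `recordEkChart … B 0 = 𝐄_k(V^{(k)}_{ax}(W_B))` (✓`pert_zero`). [cite: Balaban1987RG1, (2.4) p.266, (0.22) p.256 (bookkeeping)] -/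
theorem recordEkChart_zero (a₀ ε₂₉ : ℝ) (k : ℕ) (v : Fin (k + 1) → ℝ) (K : ℕ) (B : recordW F a₀ ε₂₉ k K) :
    recordEkChart F a₀ ε₂₉ k v K B 0 =
      ZeroInput.EkT F 2 (TβOfRecord₁₃ F 2) (chiβOfRecord₁₃Ax F 2 (thetaFill F a₀ ε₂₉)) (thetaFill F a₀ ε₂₉).εbg K (extd v) k (portVkAx F a₀ ε₂₉ k K B) := by
  rw [recordEkChart_eq, pert_zero]

/-- ★ **PRINT's CURLY BRACKET (before the `D̃` re-parametrisation and the `g_kC·` scaling of the variable) — `recordEkBracket F a₀ ε₂₉ k v K B x := recordEkChart … B x − recordEkChart … B 0`**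
= «𝐄_k(U_k(exp(iB′)V^{(k)})) − 𝐄_k(U_k(V^{(k)}))» read at the record's axial background of the charted datum `B`.  Stage 2 composes `x := C·x′ − hD̃(C·x′)` (socket (o1)) and the
coupling scaling inside the integral. [cite: Balaban1987RG1, (2.12)–(2.13) p.268, (0.22) p.256] -/
def recordEkBracket (a₀ ε₂₉ : ℝ) (k : ℕ) (v : Fin (k + 1) → ℝ) (K : ℕ) (B : recordW F a₀ ε₂₉ k K) (x : FluctIdx F k K → ℝ) : ℝ :=
  recordEkChart F a₀ ε₂₉ k v K B x - recordEkChart F a₀ ε₂₉ k v K B 0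

/-- FACE: the bracket vanishes at `x = 0`. [cite: Balaban1987RG1, (2.12) p.268 (bookkeeping)] -/
theorem recordEkBracket_zero (a₀ ε₂₉ : ℝ) (k : ℕ) (v : Fin (k + 1) → ℝ) (K : ℕ) (B : recordW F a₀ ε₂₉ k K) :
    recordEkBracket F a₀ ε₂₉ k v K B 0 = 0 :=
  sub_self _

/-- Unfolding of the bracket (`rfl`). [cite: Balaban1987RG1, (2.12) p.268 (bookkeeping)] -/
theorem recordEkBracket_eq (a₀ ε₂₉ : ℝ) (k : ℕ) (v : Fin (k + 1) → ℝ) (K : ℕ) (B : recordW F a₀ ε₂₉ k K) (x : FluctIdx F k K → ℝ) :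
    recordEkBracket F a₀ ε₂₉ k v K B x = recordEkChart F a₀ ε₂₉ k v K B x - recordEkChart F a₀ ε₂₉ k v K B 0 := rfl

end Summit.QuantumFields.YangMills.Theorems.K0RecordFormatNames

end
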